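import Summits.QuantumFields.YangMills.Theorems.LangevinControlUVFemtoCurvatureTwoPointCDefs

/-!
# Route `LangevinControlUV`, crux `FemtoCurvatureTwoPointC` (stmt-QuantumFields-16204): vocabulary of line `Sketch`, II — diagonal profiles

Part II of the route-posited statements of the skeleton `Cruxes/FemtoCurvatureTwoPointC/Lines/Sketch.lean` (continuation lead
`prover-line-stmt-QuantumFields-16204-c3-0`, reshape v4; part I is `…FemtoCurvatureTwoPointCDefs.lean`, same namespace, which see
for the conventions: NOTHING here is asserted, `AFProfilesAt` / `AFProfiles` are line statements — open, crux-sized — consumed by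
the bridge `afCouplingAt_of_afProfilesAt` of the companion file `…FemtoCurvatureTwoPointCProfilesBridge.lean`).

The point of v4: the ALL-PAIRS clause of `AFCouplingAt` (24 orientation pairs × all site pairs, `|Cov|·dist⁸ ≤ C·u(scale)²`) is
implied, for EVERY compact `G` and every `r`, by bounds on TWO one-variable diagonal profiles of ONE plaquette orientation —
transverse `f_L(s) = Cov_{L,β}(P_0^{01}, P_{s e₂}^{01})` (the crux's axis family) and longitudinal `g_L(s) = Cov_{L,β}(P_0^{01},
P_{s e₀}^{01})` — plus a variance ceiling, through the LANDED reflection-positivity structure of the predecessor crux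
(`FemtoCurvatureTwoPoint.stub_offAxisDomination` p108776: every pair covariance squared is dominated by the two diagonal families
along the direction of largest coordinate separation `m`, window `{m−1, m, m+1}`; `FemtoCurvatureTwoPoint.diagFamilies_two_profiles`
p105493: the 24 diagonal families are the two profiles; `AxisCovNonneg.stub_axisCovNonneg`: `f_L ≥ 0`) and the in-window
comparability of `u` (the scales `8(m−1) … 8⌈dist⌉`, `dist ≤ 2m`, are ≤ 2 octaves apart). So the promoted physics item can be
stated on diagonal data only.

Refs: `Cruxes/FemtoCurvatureTwoPointC/PICKED.md` (cycle 5), `Cruxes/FemtoCurvatureTwoPointC/NOTES.md`.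
-/

set_option autoImplicit false

noncomputable section

open Filter Topology MeasureTheory
open Literature.MathematicalPhysics.QuantumFieldTheory

namespace Summit.QuantumFields.YangMills.Theorems.FemtoCurvatureTwoPointC

/-- **AF profiles at fixed data `(G, r)` — the line's physics statement after reshape v4 (OPEN; crux-sized).** There
are a finite-volume coupling `u L β` and constants `u₀, c, κ₁ > 0`, `κ₃ ≥ 0`, `β₀, κ₂, C` with ADMISSIBILITY, IN-WINDOW
COMPARABILITY and the two-sided averaged dyadic ASYMPTOTIC-FREEDOM STEP LAW exactly as in `AFCouplingAt`, and, on every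
box `L` in the `u₀`-window at `β ≥ β₀` (every sub-box `8 ≤ M ≤ L` has `u M β ≤ u₀`; vacuous for `L < 8`), writing
`f_L(s) = Cov_{L,β}(P_0^{01}, P_{s e₂}^{01})` (TRANSVERSE profile — the crux's axis family) and
`g_L(s) = Cov_{L,β}(P_0^{01}, P_{s e₀}^{01})` (LONGITUDINAL profile):
* TRANSVERSE LOWER (the running-sensitive clause): `c·u(8n,β)² ≤ n⁸·f_L(n)` for `1 ≤ n`, `8n ≤ L`;
* TRANSVERSE UPPER: `s⁸·f_L(s) ≤ C·u(max 8 (min L (8s)),β)²` for `1 ≤ s`, `2s ≤ L`;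
* LONGITUDINAL UPPER: `s⁸·|g_L(s)| ≤ C·u(max 8 (min L (8s)),β)²` for `1 ≤ s`, `2s ≤ L`;
* VARIANCE CEILING: `Var_{L,β}(P_0^{01}) ≤ C·u(8,β)²`.
Only diagonal, one-variable data of one orientation appear (the shape an RG / stochastic-control engine outputs); the
all-pairs clause of `AFCouplingAt` follows (`afCouplingAt_of_afProfilesAt`). Same `P`, `E` equations as `AFCouplingAt`.
Content unchanged in kind: Bałaban-class ultraviolet stability WITH a dimension-8 observable along femto trajectories. -/
def AFProfilesAt {G : Type} [Group G] [TopologicalSpace G] [IsTopologicalGroup G] [CompactSpace G]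
    [MeasurableSpace G] [BorelSpace G] (r : LatticeRep G) : Prop :=
  ∃ (u : ℕ → ℝ → ℝ) (u₀ β₀ κ₁ κ₂ κ₃ c C : ℝ),
    0 < u₀ ∧ 0 < c ∧ 0 < κ₁ ∧ 0 ≤ κ₃ ∧
    (∀ (L : ℕ) (β : ℝ), 8 ≤ L → β₀ ≤ β → 0 < u L β) ∧
    (∀ L : ℕ, 8 ≤ L → ContinuousOn (u L) (Set.Ici β₀)) ∧
    (∀ L : ℕ, 8 ≤ L → Filter.Tendsto (u L) Filter.atTop (nhds 0)) ∧
    (∀ (L L' : ℕ) (β : ℝ), β₀ ≤ β → 8 ≤ L → L ≤ L' → L' ≤ 2 * L →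
        (∀ M : ℕ, 8 ≤ M → M ≤ L → u M β ≤ u₀) → |(u L β)⁻¹ - (u L' β)⁻¹| ≤ κ₂) ∧
    (∀ (k m : ℕ) (β : ℝ), β₀ ≤ β → (∀ M : ℕ, 8 ≤ M → M ≤ 8 * 2 ^ (k + m) → u M β ≤ u₀) →
        κ₁ * m - κ₃ ≤ (u (8 * 2 ^ k) β)⁻¹ - (u (8 * 2 ^ (k + m)) β)⁻¹ ∧
          (u (8 * 2 ^ k) β)⁻¹ - (u (8 * 2 ^ (k + m)) β)⁻¹ ≤ κ₂ * m + κ₃) ∧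
    (∀ (L : ℕ) [NeZero L] (β : ℝ) (n : ℕ), β₀ ≤ β → 1 ≤ n → 8 * n ≤ L →
        (∀ M : ℕ, 8 ≤ M → M ≤ L → u M β ≤ u₀) →
        ∀ (P : (Fin 4 → ZMod L) → Fin 4 → Fin 4 → GaugeConfig 4 L G → ℝ)
          (E : (GaugeConfig 4 L G → ℝ) → ℝ),
          (P = fun x i j U => (r.N : ℝ) - (r.ρ (plaquetteHolonomy U x i j)).trace.re) →
          (E = fun F => wilsonExpectation r.ρ β F) →
          c * u (8 * n) β ^ 2 ≤
            (n : ℝ) ^ 8 * (E (fun U => P 0 0 1 U * P (Pi.single (2 : Fin 4) ((n : ℕ) : ZMod L)) 0 1 U)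
              - E (P 0 0 1) * E (P (Pi.single (2 : Fin 4) ((n : ℕ) : ZMod L)) 0 1))) ∧
    (∀ (L : ℕ) [NeZero L] (β : ℝ) (s : ℕ), β₀ ≤ β → 1 ≤ s → 2 * s ≤ L →
        (∀ M : ℕ, 8 ≤ M → M ≤ L → u M β ≤ u₀) →
        ∀ (P : (Fin 4 → ZMod L) → Fin 4 → Fin 4 → GaugeConfig 4 L G → ℝ)
          (E : (GaugeConfig 4 L G → ℝ) → ℝ),
          (P = fun x i j U => (r.N : ℝ) - (r.ρ (plaquetteHolonomy U x i j)).trace.re) →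
          (E = fun F => wilsonExpectation r.ρ β F) →
          (s : ℝ) ^ 8 * (E (fun U => P 0 0 1 U * P (Pi.single (2 : Fin 4) ((s : ℕ) : ZMod L)) 0 1 U)
              - E (P 0 0 1) * E (P (Pi.single (2 : Fin 4) ((s : ℕ) : ZMod L)) 0 1)) ≤
            C * u (max 8 (min L (8 * s))) β ^ 2) ∧
    (∀ (L : ℕ) [NeZero L] (β : ℝ) (s : ℕ), β₀ ≤ β → 1 ≤ s → 2 * s ≤ L →
        (∀ M : ℕ, 8 ≤ M → M ≤ L → u M β ≤ u₀) →
        ∀ (P : (Fin 4 → ZMod L) → Fin 4 → Fin 4 → GaugeConfig 4 L G → ℝ)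
          (E : (GaugeConfig 4 L G → ℝ) → ℝ),
          (P = fun x i j U => (r.N : ℝ) - (r.ρ (plaquetteHolonomy U x i j)).trace.re) →
          (E = fun F => wilsonExpectation r.ρ β F) →
          (s : ℝ) ^ 8 * |E (fun U => P 0 0 1 U * P (Pi.single (0 : Fin 4) ((s : ℕ) : ZMod L)) 0 1 U)
              - E (P 0 0 1) * E (P (Pi.single (0 : Fin 4) ((s : ℕ) : ZMod L)) 0 1)| ≤
            C * u (max 8 (min L (8 * s))) β ^ 2) ∧
    (∀ (L : ℕ) [NeZero L] (β : ℝ), β₀ ≤ β → (∀ M : ℕ, 8 ≤ M → M ≤ L → u M β ≤ u₀) →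
        ∀ (P : (Fin 4 → ZMod L) → Fin 4 → Fin 4 → GaugeConfig 4 L G → ℝ)
          (E : (GaugeConfig 4 L G → ℝ) → ℝ),
          (P = fun x i j U => (r.N : ℝ) - (r.ρ (plaquetteHolonomy U x i j)).trace.re) →
          (E = fun F => wilsonExpectation r.ρ β F) →
          E (fun U => P 0 0 1 U * P 0 0 1 U) - E (P 0 0 1) * E (P 0 0 1) ≤ C * u 8 β ^ 2)

/-- **AF profiles (universal closure)**: for every compact simple `G` (any Borel structure) and faithful unitary `r`,
`AFProfilesAt r`. This is the registered stub `stub_afProfiles` of line `Sketch` (skeleton v4), by name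
(`afProfiles_iff_stub`). OPEN. -/
def AFProfiles : Prop :=
  ∀ (G : Type) [Group G] [TopologicalSpace G] [IsTopologicalGroup G] [CompactSpace G]
    [MeasurableSpace G] [BorelSpace G], IsCompactSimpleLieGroup G →
    ∀ r : LatticeRep G, AFProfilesAt r

/-- `AFProfiles` is, definitionally, the registered stub signature of `stub_afProfiles` (line `Sketch`, skeleton v4,
crux stmt-QuantumFields-16204) — so a proof of that stub is a proof of `AFProfiles` and conversely. -/
theorem afProfiles_iff_stub :
    AFProfiles ↔
      ∀ (G : Type) [Group G] [TopologicalSpace G] [IsTopologicalGroup G] [CompactSpace G]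
        [MeasurableSpace G] [BorelSpace G], IsCompactSimpleLieGroup G →
        ∀ r : LatticeRep G, ∃ (u : ℕ → ℝ → ℝ) (u₀ β₀ κ₁ κ₂ κ₃ c C : ℝ),
          0 < u₀ ∧ 0 < c ∧ 0 < κ₁ ∧ 0 ≤ κ₃ ∧
          (∀ (L : ℕ) (β : ℝ), 8 ≤ L → β₀ ≤ β → 0 < u L β) ∧
          (∀ L : ℕ, 8 ≤ L → ContinuousOn (u L) (Set.Ici β₀)) ∧
          (∀ L : ℕ, 8 ≤ L → Filter.Tendsto (u L) Filter.atTop (nhds 0)) ∧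
          (∀ (L L' : ℕ) (β : ℝ), β₀ ≤ β → 8 ≤ L → L ≤ L' → L' ≤ 2 * L →
              (∀ M : ℕ, 8 ≤ M → M ≤ L → u M β ≤ u₀) → |(u L β)⁻¹ - (u L' β)⁻¹| ≤ κ₂) ∧
          (∀ (k m : ℕ) (β : ℝ), β₀ ≤ β → (∀ M : ℕ, 8 ≤ M → M ≤ 8 * 2 ^ (k + m) → u M β ≤ u₀) →
              κ₁ * m - κ₃ ≤ (u (8 * 2 ^ k) β)⁻¹ - (u (8 * 2 ^ (k + m)) β)⁻¹ ∧
                (u (8 * 2 ^ k) β)⁻¹ - (u (8 * 2 ^ (k + m)) β)⁻¹ ≤ κ₂ * m + κ₃) ∧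
          (∀ (L : ℕ) [NeZero L] (β : ℝ) (n : ℕ), β₀ ≤ β → 1 ≤ n → 8 * n ≤ L →
              (∀ M : ℕ, 8 ≤ M → M ≤ L → u M β ≤ u₀) →
              ∀ (P : (Fin 4 → ZMod L) → Fin 4 → Fin 4 → GaugeConfig 4 L G → ℝ)
                (E : (GaugeConfig 4 L G → ℝ) → ℝ),
                (P = fun x i j U => (r.N : ℝ) - (r.ρ (plaquetteHolonomy U x i j)).trace.re) →
                (E = fun F => wilsonExpectation r.ρ β F) →
                c * u (8 * n) β ^ 2 ≤
                  (n : ℝ) ^ 8 * (E (fun U => P 0 0 1 U * P (Pi.single (2 : Fin 4) ((n : ℕ) : ZMod L)) 0 1 U)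
                    - E (P 0 0 1) * E (P (Pi.single (2 : Fin 4) ((n : ℕ) : ZMod L)) 0 1))) ∧
          (∀ (L : ℕ) [NeZero L] (β : ℝ) (s : ℕ), β₀ ≤ β → 1 ≤ s → 2 * s ≤ L →
              (∀ M : ℕ, 8 ≤ M → M ≤ L → u M β ≤ u₀) →
              ∀ (P : (Fin 4 → ZMod L) → Fin 4 → Fin 4 → GaugeConfig 4 L G → ℝ)
                (E : (GaugeConfig 4 L G → ℝ) → ℝ),
                (P = fun x i j U => (r.N : ℝ) - (r.ρ (plaquetteHolonomy U x i j)).trace.re) →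
                (E = fun F => wilsonExpectation r.ρ β F) →
                (s : ℝ) ^ 8 * (E (fun U => P 0 0 1 U * P (Pi.single (2 : Fin 4) ((s : ℕ) : ZMod L)) 0 1 U)
                    - E (P 0 0 1) * E (P (Pi.single (2 : Fin 4) ((s : ℕ) : ZMod L)) 0 1)) ≤
                  C * u (max 8 (min L (8 * s))) β ^ 2) ∧
          (∀ (L : ℕ) [NeZero L] (β : ℝ) (s : ℕ), β₀ ≤ β → 1 ≤ s → 2 * s ≤ L →
              (∀ M : ℕ, 8 ≤ M → M ≤ L → u M β ≤ u₀) →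
              ∀ (P : (Fin 4 → ZMod L) → Fin 4 → Fin 4 → GaugeConfig 4 L G → ℝ)
                (E : (GaugeConfig 4 L G → ℝ) → ℝ),
                (P = fun x i j U => (r.N : ℝ) - (r.ρ (plaquetteHolonomy U x i j)).trace.re) →
                (E = fun F => wilsonExpectation r.ρ β F) →
                (s : ℝ) ^ 8 * |E (fun U => P 0 0 1 U * P (Pi.single (0 : Fin 4) ((s : ℕ) : ZMod L)) 0 1 U)
                    - E (P 0 0 1) * E (P (Pi.single (0 : Fin 4) ((s : ℕ) : ZMod L)) 0 1)| ≤
                  C * u (max 8 (min L (8 * s))) β ^ 2) ∧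
          (∀ (L : ℕ) [NeZero L] (β : ℝ), β₀ ≤ β → (∀ M : ℕ, 8 ≤ M → M ≤ L → u M β ≤ u₀) →
              ∀ (P : (Fin 4 → ZMod L) → Fin 4 → Fin 4 → GaugeConfig 4 L G → ℝ)
                (E : (GaugeConfig 4 L G → ℝ) → ℝ),
                (P = fun x i j U => (r.N : ℝ) - (r.ρ (plaquetteHolonomy U x i j)).trace.re) →
                (E = fun F => wilsonExpectation r.ρ β F) →
                E (fun U => P 0 0 1 U * P 0 0 1 U) - E (P 0 0 1) * E (P 0 0 1) ≤ C * u 8 β ^ 2) :=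
  Iff.rfl

end Summit.QuantumFields.YangMills.Theorems.FemtoCurvatureTwoPointC

end
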